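import Literature.Geometry.Symplectic.SteinHandleDomain
import Literature.Geometry.Symplectic.SteinLeviHypersurface
import Literature.Geometry.Symplectic.SteinJConvexOpen
import HarnessLib

/-!
# Flat Fritzsche–Grauert II.4.5 in `ℝ⁴`, and a strictly plurisubharmonic defining function for Eliashberg's handlebody

Topic `Literature/Geometry/Symplectic`; proofs file of the fact seat of
`Literature.Geometry.Symplectic.Gompf1998_thm13_twoHandles` (**E2**, `SteinTwoHandles.lean`).
`SteinLeviHypersurface.lean` proves, on the tree's `4`-manifolds, that a smooth function whose
level sets have positive Levi form on their complex tangencies along a compact set `K` becomes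
strictly `J`-convex near `K` after composing with `e^{C·}` (Fritzsche–Grauert, Ch. II,
Thm. 4.5, (1) ⇒ (2)).  This file proves the **flat version on `ℝ⁴ = ℂ²`** for a constant
complex structure `J₀` (`J₀² = -1`) and the flat Levi form
`D²Ψ(u,u) + D²Ψ(J₀u,J₀u) = -dd^ℂΨ(u, J₀u)` (`neg_extDeriv_dComplexFlat_self`):

* §1 the flat Levi form of `e^{CΨ}`: `C e^{CΨ} (L_Ψ(u) + C (dΨ(u)² + dΨ(J₀u)²))`
  (`levi_flat_exp_const_mul`);
* §2 `exists_levi_flat_exp_pos_of_isCompact`: positivity on complex tangencies along a compact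
  `K` ⇒ `e^{CΨ}` strictly `J₀`-plurisubharmonic on a neighbourhood of `K` for all large `C`;
* §3 applied to Eliashberg's handlebody `K = {|x| ≤ h(|y|)}` (`SteinHandleDomain.lean`): for
  every `R`, `e^{Cρ_K}` is strictly plurisubharmonic near `∂K ∩ B̄_R` for `C` large
  (`HandleProfile.exists_psh_definingFunction`) — a `J`-convex defining function of the
  strongly pseudoconvex handlebody near any compact part of its boundary, as used to glue the
  handle to a Stein domain (Eliashberg 1990, §3; Forstnerič–Kozak 2003, §4).

Everything is **proved**; no definition, no named fact.

## References

* K. Fritzsche, H. Grauert, *From holomorphic functions to complex manifolds*, GTM 213,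
  Springer 2002, Ch. II Thm. 4.5. [FritzscheGrauert2002]
* F. Forstnerič, J. Kozak, *Strongly pseudoconvex handlebodies*, J. Korean Math. Soc. 40
  (2003), 727–745, Cor. 3.2, §4. [ForstnericKozak2003]
* Ya. Eliashberg, *Topological characterization of Stein manifolds of dimension > 2*,
  Internat. J. Math. 1 (1990), 29–46, Lemma 3.4.3. [Eliashberg1990Stein]
-/

noncomputable section

open scoped Manifold ContDiff Topology
open Set Function Filter

namespace Literature.Geometry.Symplectic

local notation "E4" => EuclideanSpace ℝ (Fin 4)

section Flat

variable {J₀ : E4 →L[ℝ] E4} {Ψ : E4 → ℝ}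

/-! ### §1 The flat Levi form of `e^{CΨ}` -/

/-- The derivative of `e^{CΨ}`: `d(e^{CΨ})_w = C e^{CΨ(w)} dΨ_w`. [folklore] -/
theorem hasFDerivAt_exp_const_mul_comp (hΨ : Differentiable ℝ Ψ) (C : ℝ) (w : E4) :
    HasFDerivAt (fun y => Real.exp (C * Ψ y)) ((C * Real.exp (C * Ψ w)) • fderiv ℝ Ψ w) w := by
  have h1 : HasFDerivAt (fun y => C * Ψ y) (C • fderiv ℝ Ψ w) w :=
    (hΨ w).hasFDerivAt.const_mul C
  have h2 := (Real.hasDerivAt_exp (C * Ψ w)).comp_hasFDerivAt w h1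
  have h3 : Real.exp (C * Ψ w) • C • fderiv ℝ Ψ w = (C * Real.exp (C * Ψ w)) • fderiv ℝ Ψ w := by
    rw [smul_smul, mul_comm]
  rw [h3] at h2
  exact h2

/-- `fderiv` form of the previous lemma. [folklore] -/
theorem fderiv_exp_const_mul_comp (hΨ : Differentiable ℝ Ψ) (C : ℝ) :
    fderiv ℝ (fun y => Real.exp (C * Ψ y)) = fun w => (C * Real.exp (C * Ψ w)) • fderiv ℝ Ψ w :=
  funext fun w => (hasFDerivAt_exp_const_mul_comp hΨ C w).fderiv

/-- **The second derivative of `e^{CΨ}`**: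
`D²(e^{CΨ})_w(u, u) = C e^{CΨ(w)} (D²Ψ_w(u,u) + C (dΨ_w u)²)`. [folklore] -/
theorem fderiv_fderiv_exp_const_mul_comp_apply (hΨ : ContDiff ℝ ∞ Ψ) (C : ℝ) (w u : E4) :
    fderiv ℝ (fderiv ℝ fun y => Real.exp (C * Ψ y)) w u u =
      C * Real.exp (C * Ψ w) * (fderiv ℝ (fderiv ℝ Ψ) w u u + C * (fderiv ℝ Ψ w u) ^ 2) := by
  have hd : Differentiable ℝ Ψ := hΨ.differentiable (by simp)
  have hd2 : Differentiable ℝ (fderiv ℝ Ψ) := (hΨ.fderiv_right (m := ∞) (by norm_cast)).differentiable (by simp)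
  rw [fderiv_exp_const_mul_comp hd C]
  -- product rule for `g • F`, `g = C e^{CΨ}`, `F = dΨ`
  have hg : HasFDerivAt (fun y => C * Real.exp (C * Ψ y))
      (C • ((C * Real.exp (C * Ψ w)) • fderiv ℝ Ψ w)) w :=
    (hasFDerivAt_exp_const_mul_comp hd C w).const_mul C
  have hF : HasFDerivAt (fderiv ℝ Ψ) (fderiv ℝ (fderiv ℝ Ψ) w) w := (hd2 w).hasFDerivAt
  have hprod := hg.smul hF
  rw [show (fun w => (C * Real.exp (C * Ψ w)) • fderiv ℝ Ψ w) =
      (fun y => C * Real.exp (C * Ψ y)) • fderiv ℝ Ψ from rfl, hprod.fderiv]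
  simp only [FunLike.coe_add, FunLike.coe_smul, Pi.add_apply, Pi.smul_apply,
    smul_eq_mul, ContinuousLinearMap.smulRight_apply]
  ring

/-- **The flat Levi form of `e^{CΨ}`**: with `J₀² = -1`,
`L_{e^{CΨ}}(w)(u) = C e^{CΨ(w)} (L_Ψ(w)(u) + C (dΨ_w(u)² + dΨ_w(J₀u)²))`, where
`L_Ψ(w)(u) = D²Ψ_w(u,u) + D²Ψ_w(J₀u,J₀u)`. [cite: FritzscheGrauert2002, Ch. II Thm. 4.5] -/
theorem levi_flat_exp_const_mul (hΨ : ContDiff ℝ ∞ Ψ) (C : ℝ) (w u : E4) :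
    fderiv ℝ (fderiv ℝ fun y => Real.exp (C * Ψ y)) w u u +
        fderiv ℝ (fderiv ℝ fun y => Real.exp (C * Ψ y)) w (J₀ u) (J₀ u) =
      C * Real.exp (C * Ψ w) *
        ((fderiv ℝ (fderiv ℝ Ψ) w u u + fderiv ℝ (fderiv ℝ Ψ) w (J₀ u) (J₀ u)) +
          C * (fderiv ℝ Ψ w u ^ 2 + fderiv ℝ Ψ w (J₀ u) ^ 2)) := by
  rw [fderiv_fderiv_exp_const_mul_comp_apply hΨ, fderiv_fderiv_exp_const_mul_comp_apply hΨ]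
  ring

/-- `e^{CΨ}` is smooth. [folklore] -/
theorem contDiff_exp_const_mul_comp (hΨ : ContDiff ℝ ∞ Ψ) (C : ℝ) :
    ContDiff ℝ ∞ fun y => Real.exp (C * Ψ y) :=
  Real.contDiff_exp.comp (contDiff_const.mul hΨ)

/-! ### §2 Positivity along a compact set of `J`-convex level points -/

/-- **Pointwise: positivity modulo `dΨ² + (dΨ∘J₀)²`.** [cite: FritzscheGrauert2002, Ch. II Thm. 4.5] -/
theorem exists_levi_flat_add_mul_sq_pos (w : E4)
    (hξ : ∀ u : E4, u ≠ 0 → fderiv ℝ Ψ w u = 0 → fderiv ℝ Ψ w (J₀ u) = 0 →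
      0 < fderiv ℝ (fderiv ℝ Ψ) w u u + fderiv ℝ (fderiv ℝ Ψ) w (J₀ u) (J₀ u)) :
    ∃ C : ℝ, 0 ≤ C ∧ ∀ C' : ℝ, C ≤ C' → ∀ u : E4, u ≠ 0 →
      0 < (fderiv ℝ (fderiv ℝ Ψ) w u u + fderiv ℝ (fderiv ℝ Ψ) w (J₀ u) (J₀ u)) +
        C' * (fderiv ℝ Ψ w u ^ 2 + fderiv ℝ Ψ w (J₀ u) ^ 2) := by
  set B := fderiv ℝ (fderiv ℝ Ψ) w with hB
  set ℓ := fderiv ℝ Ψ w with hℓ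
  refine exists_pos_add_mul_of_homogeneous (L := fun u => B u u + B (J₀ u) (J₀ u))
    (n := fun u => ℓ u ^ 2 + ℓ (J₀ u) ^ 2) ?_ ?_ (fun u => by positivity) ?_ ?_ ?_
  · exact ((B.continuous.clm_apply continuous_id).add
      ((B.continuous.comp J₀.continuous).clm_apply J₀.continuous))
  · exact (ℓ.continuous.pow 2).add ((ℓ.continuous.comp J₀.continuous).pow 2)
  · intro t u
    show B (t • u) (t • u) + B (J₀ (t • u)) (J₀ (t • u)) = t ^ 2 * (B u u + B (J₀ u) (J₀ u))
    simp only [map_smul, FunLike.coe_smul, Pi.smul_apply, smul_eq_mul]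
    ring
  · intro t u
    show ℓ (t • u) ^ 2 + ℓ (J₀ (t • u)) ^ 2 = t ^ 2 * (ℓ u ^ 2 + ℓ (J₀ u) ^ 2)
    simp only [map_smul, smul_eq_mul]
    ring
  · intro u hu hn
    have h1 : ℓ u ^ 2 = 0 := by nlinarith [sq_nonneg (ℓ u), sq_nonneg (ℓ (J₀ u))]
    have h2 : ℓ (J₀ u) ^ 2 = 0 := by nlinarith [sq_nonneg (ℓ u), sq_nonneg (ℓ (J₀ u))]
    exact hξ u hu (pow_eq_zero_iff two_ne_zero |>.1 h1) (pow_eq_zero_iff two_ne_zero |>.1 h2)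

/-- **Locally uniformly.** [cite: FritzscheGrauert2002, Ch. II Thm. 4.5] -/
theorem exists_nhds_levi_flat_add_mul_sq_pos (hΨ : ContDiff ℝ ∞ Ψ) {w₀ : E4}
    (hξ : ∀ u : E4, u ≠ 0 → fderiv ℝ Ψ w₀ u = 0 → fderiv ℝ Ψ w₀ (J₀ u) = 0 →
      0 < fderiv ℝ (fderiv ℝ Ψ) w₀ u u + fderiv ℝ (fderiv ℝ Ψ) w₀ (J₀ u) (J₀ u)) :
    ∃ U ∈ 𝓝 w₀, ∃ C : ℝ, 0 ≤ C ∧ ∀ C' : ℝ, C ≤ C' → ∀ w ∈ U, ∀ u : E4, u ≠ 0 →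
      0 < (fderiv ℝ (fderiv ℝ Ψ) w u u + fderiv ℝ (fderiv ℝ Ψ) w (J₀ u) (J₀ u)) +
        C' * (fderiv ℝ Ψ w u ^ 2 + fderiv ℝ Ψ w (J₀ u) ^ 2) := by
  obtain ⟨C₁, hC₁0, hC₁⟩ := exists_levi_flat_add_mul_sq_pos (J₀ := J₀) w₀ hξ
  set C := C₁ + 1 with hC
  -- the family `f w u = L_Ψ(w)(u) + C n_Ψ(w)(u)` is continuous and homogeneous
  set f : E4 → E4 → ℝ := fun w u =>
    (fderiv ℝ (fderiv ℝ Ψ) w u u + fderiv ℝ (fderiv ℝ Ψ) w (J₀ u) (J₀ u)) +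
      C * (fderiv ℝ Ψ w u ^ 2 + fderiv ℝ Ψ w (J₀ u) ^ 2) with hf
  have hB : Continuous (fderiv ℝ (fderiv ℝ Ψ)) :=
    (hΨ.fderiv_right (m := ∞) (by norm_cast)).continuous_fderiv (by simp)
  have hℓ : Continuous (fderiv ℝ Ψ) := hΨ.continuous_fderiv (by simp)
  have hcont : Continuous (uncurry f) := by
    have h1 : Continuous fun p : E4 × E4 => fderiv ℝ (fderiv ℝ Ψ) p.1 := hB.comp continuous_fst
    have h2 : Continuous fun p : E4 × E4 => p.2 := continuous_snd
    have h3 : Continuous fun p : E4 × E4 => J₀ p.2 := J₀.continuous.comp continuous_snd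
    have h4 : Continuous fun p : E4 × E4 => fderiv ℝ Ψ p.1 := hℓ.comp continuous_fst
    exact (((h1.clm_apply h2).clm_apply h2).add ((h1.clm_apply h3).clm_apply h3)).add
      (continuous_const.mul (((h4.clm_apply h2).pow 2).add ((h4.clm_apply h3).pow 2)))
  have hhom : ∀ w u (t : ℝ), f w (t • u) = t ^ 2 * f w u := by
    intro w u t
    simp only [hf, map_smul, FunLike.coe_smul, Pi.smul_apply, smul_eq_mul]
    ring
  have hpos : ∀ u, u ≠ 0 → 0 < f w₀ u := fun u hu => hC₁ C (by rw [hC]; linarith) u hu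
  have hev := eventually_forall_pos_of_homogeneous (fun u _ => hcont.continuousAt) hhom hpos
  refine ⟨{w | ∀ u, u ≠ 0 → 0 < f w u}, hev, C, by rw [hC]; linarith, fun C' hC' w hw u hu => ?_⟩
  have h1 : 0 < f w u := hw u hu
  simp only [hf] at h1
  have h3 : 0 ≤ (C' - C) * (fderiv ℝ Ψ w u ^ 2 + fderiv ℝ Ψ w (J₀ u) ^ 2) :=
    mul_nonneg (by linarith) (by positivity)
  nlinarith

/-- **Uniformly on compact sets (flat Fritzsche–Grauert II.4.5, (1) ⇒ (2)).**
[cite: FritzscheGrauert2002, Ch. II Thm. 4.5] -/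
theorem exists_levi_flat_add_mul_sq_pos_of_isCompact (hΨ : ContDiff ℝ ∞ Ψ) {K : Set E4} (hK : IsCompact K)
    (hξ : ∀ w ∈ K, ∀ u : E4, u ≠ 0 → fderiv ℝ Ψ w u = 0 → fderiv ℝ Ψ w (J₀ u) = 0 →
      0 < fderiv ℝ (fderiv ℝ Ψ) w u u + fderiv ℝ (fderiv ℝ Ψ) w (J₀ u) (J₀ u)) :
    ∃ U : Set E4, IsOpen U ∧ K ⊆ U ∧ ∃ C : ℝ, 0 ≤ C ∧ ∀ C' : ℝ, C ≤ C' → ∀ w ∈ U, ∀ u : E4, u ≠ 0 →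
      0 < (fderiv ℝ (fderiv ℝ Ψ) w u u + fderiv ℝ (fderiv ℝ Ψ) w (J₀ u) (J₀ u)) +
        C' * (fderiv ℝ Ψ w u ^ 2 + fderiv ℝ Ψ w (J₀ u) ^ 2) := by
  choose! U hU C hC0 hC using
    fun w (hw : w ∈ K) => exists_nhds_levi_flat_add_mul_sq_pos (J₀ := J₀) hΨ (w₀ := w) (hξ w hw)
  obtain ⟨t, htK, hcover⟩ :=
    hK.elim_nhds_subcover (fun w => interior (U w)) fun w hw => interior_mem_nhds.2 (hU w hw)
  refine ⟨⋃ w ∈ t, interior (U w), isOpen_biUnion fun w _ => isOpen_interior, hcover,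
    ∑ w ∈ t, C w, Finset.sum_nonneg fun w hw => hC0 w (htK w hw), fun C' hC' w hw u hu => ?_⟩
  obtain ⟨y, hy, hwy⟩ := mem_iUnion₂.1 hw
  have hyK : y ∈ K := htK y hy
  have hCy : C y ≤ C' := (Finset.single_le_sum (fun z hz => hC0 z (htK z hz)) hy).trans hC'
  exact hC y hyK C' hCy w (interior_subset hwy) u hu

/-- **`e^{CΨ}` is strictly `J₀`-plurisubharmonic near `K` for `C` large** (flat
Fritzsche–Grauert II.4.5): in the tree's language, `-dd^ℂ(e^{CΨ})_w(u, J₀u) > 0` for all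
`w` in a neighbourhood of `K`, `u ≠ 0`, `C ≥ C₀`. [cite: FritzscheGrauert2002, Ch. II Thm. 4.5] -/
theorem exists_levi_flat_exp_pos_of_isCompact (hΨ : ContDiff ℝ ∞ Ψ) (hJ : ∀ v, J₀ (J₀ v) = -v)
    {K : Set E4} (hK : IsCompact K)
    (hξ : ∀ w ∈ K, ∀ u : E4, u ≠ 0 → fderiv ℝ Ψ w u = 0 → fderiv ℝ Ψ w (J₀ u) = 0 →
      0 < fderiv ℝ (fderiv ℝ Ψ) w u u + fderiv ℝ (fderiv ℝ Ψ) w (J₀ u) (J₀ u)) :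
    ∃ U : Set E4, IsOpen U ∧ K ⊆ U ∧ ∃ C₀ : ℝ, 0 < C₀ ∧ ∀ C : ℝ, C₀ ≤ C → ∀ w ∈ U, ∀ u : E4, u ≠ 0 →
      0 < -(extDeriv (dComplexFlat J₀ fun y => Real.exp (C * Ψ y)) w ![u, J₀ u]) := by
  obtain ⟨U, hUo, hKU, C, hC0, hC⟩ := exists_levi_flat_add_mul_sq_pos_of_isCompact (J₀ := J₀) hΨ hK hξ
  refine ⟨U, hUo, hKU, C + 1, by linarith, fun C' hC' w hw u hu => ?_⟩
  have hC'0 : 0 < C' := by linarith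
  rw [neg_extDeriv_dComplexFlat_self J₀ (contDiff_exp_const_mul_comp hΨ C') hJ w u,
    levi_flat_exp_const_mul hΨ C' w u]
  exact mul_pos (mul_pos hC'0 (Real.exp_pos _)) (hC C' (by linarith) w hw u hu)

end Flat

/-! ### §3 A strictly plurisubharmonic defining function for Eliashberg's handlebody -/

namespace HandleProfile

variable {h : ℝ → ℝ} {σ r₀ : ℝ} (H : HandleProfile h σ r₀)
include H

/-- **A `J`-convex defining function near any compact part of `∂K`** (Eliashberg 1990, §3;
Forstnerič–Kozak 2003, §4; via flat Fritzsche–Grauert II.4.5): for the handlebody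
`K = {ρ_K ≤ 0}`, `ρ_K = |x|² - θ_K(|y|²)`, and every radius `R`, there are a neighbourhood `U`
of `∂K ∩ B̄(0, R)` and `C₀ > 0` such that `e^{Cρ_K}` is strictly `J₁`-plurisubharmonic on `U` for
every `C ≥ C₀`: `-dd^ℂ(e^{Cρ_K})_w(u, J₁u) > 0` for `w ∈ U`, `u ≠ 0`.
[cite: ForstnericKozak2003, Cor. 3.2] [cite: FritzscheGrauert2002, Ch. II Thm. 4.5] -/
theorem exists_psh_definingFunction (R : ℝ) :
    ∃ U : Set E4, IsOpen U ∧ {w | spherical (thetaK h) w = 0} ∩ Metric.closedBall 0 R ⊆ U ∧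
      ∃ C₀ : ℝ, 0 < C₀ ∧ ∀ C : ℝ, C₀ ≤ C → ∀ w ∈ U, ∀ u : E4, u ≠ 0 →
        0 < -(extDeriv (dComplexFlat (scaledComplexStructure 1) fun y =>
          Real.exp (C * spherical (thetaK h) y)) w ![u, scaledComplexStructure 1 u]) := by
  have hΨ : ContDiff ℝ ∞ (spherical (thetaK h)) := contDiff_spherical H.contDiff_thetaK
  have hK : IsCompact ({w : E4 | spherical (thetaK h) w = 0} ∩ Metric.closedBall 0 R) :=
    (isCompact_closedBall (0 : E4) R).inter_left (isClosed_eq hΨ.continuous continuous_const)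
  exact exists_levi_flat_exp_pos_of_isCompact hΨ (scaledComplexStructure_sq one_ne_zero) hK
    fun w hw u hu h1 h2 => H.levi_handleDomain_pos hw.1 hu h1 h2

end HandleProfile

end Literature.Geometry.Symplectic

end
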